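import Literature.Probability.Percolation.StarTriangleKernels
import HarnessLib

/-!
# Open walks through a star–triangle transformation

Grimmett–Manolescu, *Bond percolation on isoradial graphs* (PTRF 159 (2014) 273–327 =
arXiv:1204.0505), §5.2, last paragraph ("a star–triangle transformation maps an open path of
`G` to an open path of `G'`", with Fig. 5.4) and §5.3, Figs. 5.5–5.6 ("the image path contains
the black vertices and, in addition, possibly some of the blue ones"). For the pathwise analysis
of §6.2 (the heights of the images
`γ^k` of an open path) the transport of a path must be an explicit *function* of the path, the
configuration and the randomness, local at the hexagon of the move. This file provides it for
the two moves of `Literature.Probability.Percolation.StarTriangleKernels` (`tMove`, `sMove`),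
for walks written as lists of vertices:

* `StarTriangle.IsWalk ω W` — consecutive vertices of `W` are joined by `ω`-open edges
  (`= List.IsChain (fun a b => s(a, b) ∈ ω) W`, `isWalk_iff_isChain`).
* `StarTriangle.subdivide v O W` — the image of a walk under the **triangle → star** move at the
  triangle `v` with new centre `O`: every traversal of a triangle edge `ab` becomes `a O b`
  (forced: the coupling preserves the connections among the corners, `compatible_tMap`);
  `isWalk_subdivide`: it is open in `tMove … ω u` for *every* `u`.
* `StarTriangle.contract v O t W` — the image under the **star → triangle** move with outcome
  `t` (the triangle configuration laid down): every passage `a O b` through the centre becomes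
  `a b` if that edge is laid down, and the detour `a c b` through the third corner otherwise
  (`a O a` becomes `a`); `isWalk_contract`: open in `sMove … ω u` when `t` is the outcome
  `readLocal (triEdge v) (sMove … ω u)` (`compatible_sMap`).
* Bookkeeping used by the height analysis of GM14 §6.2: the endpoints are unchanged
  (`head?_subdivide`, `getLast?_subdivide`, `head?_contract`, `getLast?_contract`), and the
  provenance of vertices and of consecutive pairs of the image (`mem_subdivide`,
  `mem_contract`, `infix_pair_subdivide`, `infix_pair_contract`): a vertex of the image is an
  old vertex, the centre (triangle → star), or the third corner of a detour `a c b` replacing a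
  passage `a O b` whose direct edge was not laid down (star → triangle).

Relabelling by a bijection of the vertices (`List.map`) is covered by `isWalk_map`.

## References

* G. R. Grimmett, I. Manolescu, PTRF 159 (2014) 273–327, arXiv:1204.0505, §5.2 (last
  paragraph and Figure 5.4: how an open path is transported by `T` and `S`), §5.3 (Figures
  5.5–5.6: black and blue vertices), §6.2.
* G. R. Grimmett, I. Manolescu, Ann. Probab. 41 (2013), arXiv:1105.5535, Prop. 2.2 (the
  couplings preserve connections among the corners).
-/

namespace Literature.Probability.Percolation

namespace StarTriangle

open LatticeModels

variable {V : Type*}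

/-! ### Small list lemmas -/

/-- Strong induction on the length of a list. [folklore] -/
theorem list_strong_induction {P : List V → Prop}
    (h : ∀ W : List V, (∀ W' : List V, W'.length < W.length → P W') → P W) (W : List V) : P W :=
  (measure List.length).wf.induction W fun W ih => h W ih

/-- The last element of `a :: L` is that of `L` when `L` is nonempty. [folklore] -/
theorem getLast?_cons_of_ne_nil {a : V} {L : List V} (h : L ≠ []) : (a :: L).getLast? = L.getLast? := by
  cases L with
  | nil => exact absurd rfl h
  | cons b l => exact List.getLast?_cons_cons

/-- A two-element prefix determines the first two entries. [folklore] -/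
theorem pair_prefix_cons_iff {x y z : V} {L : List V} : [x, y] <+: z :: L ↔ x = z ∧ [y] <+: L := by
  simp [List.cons_prefix_cons]

/-- A one-element prefix is the head. [folklore] -/
theorem singleton_prefix_iff {y : V} {L : List V} : [y] <+: L ↔ L.head? = some y := by
  cases L with
  | nil => simp
  | cons z L => simp [List.cons_prefix_cons, eq_comm]

/-- The first two entries form an infix. [folklore] -/
theorem pair_infix_cons_cons (a b : V) (l : List V) : [a, b] <:+: a :: b :: l := ⟨[], l, by simp⟩

/-- The first three entries form an infix. [folklore] -/
theorem triple_infix_cons_cons_cons (a b c : V) (l : List V) : [a, b, c] <:+: a :: b :: c :: l :=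
  ⟨[], l, by simp⟩

/-! ### Walks -/

/-- `W` is an **`ω`-open walk**: any two consecutive vertices are joined by an edge of `ω`.
This is `List.IsChain (fun a b => s(a, b) ∈ ω) W` (`isWalk_iff_isChain`), written by structural
recursion so that proofs about the walk surgery below can pattern-match on the walk.
[cite: GrimmettManolescu2014Isoradial, §5.2] -/
def IsWalk (ω : Set (Sym2 V)) : List V → Prop
  | [] => True
  | [_] => True
  | a :: b :: l => s(a, b) ∈ ω ∧ IsWalk ω (b :: l)

/-- **`IsWalk` is `List.IsChain`** for the relation "joined by an `ω`-open edge" (the tree's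
list-walk convention, e.g. `ArmSeparationRing`, `HamiltonianGadgetTransport`). [folklore] -/
theorem isWalk_iff_isChain (ω : Set (Sym2 V)) : ∀ W : List V, IsWalk ω W ↔ List.IsChain (fun a b => s(a, b) ∈ ω) W
  | [] => by simp [IsWalk]
  | [a] => by simp [IsWalk]
  | a :: b :: l => by rw [List.isChain_cons_cons, ← isWalk_iff_isChain ω (b :: l)]; rfl

/-- The empty list is a walk. [folklore] -/
@[simp] theorem isWalk_nil (ω : Set (Sym2 V)) : IsWalk ω [] := trivial

/-- A single vertex is a walk. [folklore] -/
@[simp] theorem isWalk_singleton (ω : Set (Sym2 V)) (a : V) : IsWalk ω [a] := trivial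

/-- Unfolding a walk at its first edge. [folklore] -/
@[simp] theorem isWalk_cons_cons (ω : Set (Sym2 V)) (a b : V) (l : List V) :
    IsWalk ω (a :: b :: l) ↔ s(a, b) ∈ ω ∧ IsWalk ω (b :: l) := Iff.rfl

/-- The tail of a walk is a walk. [folklore] -/
theorem IsWalk.tail {ω : Set (Sym2 V)} {a : V} {l : List V} (h : IsWalk ω (a :: l)) : IsWalk ω l := by
  cases l with
  | nil => trivial
  | cons b l => exact h.2

/-- Prepending a vertex joined to the head. [folklore] -/
theorem IsWalk.cons {ω : Set (Sym2 V)} {a : V} {l : List V} (h : IsWalk ω l)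
    (ha : ∀ b, l.head? = some b → s(a, b) ∈ ω) : IsWalk ω (a :: l) := by
  cases l with
  | nil => trivial
  | cons b l => exact ⟨ha b rfl, h⟩

/-- Consecutive vertices of a walk are joined by an open edge (`List.IsChain.infix`). [folklore] -/
theorem IsWalk.mem_of_infix {ω : Set (Sym2 V)} {x y : V} {W : List V} (hW : IsWalk ω W) (h : [x, y] <:+: W) :
    s(x, y) ∈ ω :=
  List.isChain_pair.1 (((isWalk_iff_isChain ω W).1 hW).infix h)

/-- Monotonicity in the configuration on the edges actually used. [folklore] -/
theorem IsWalk.of_forall_mem {ω ω' : Set (Sym2 V)} :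
    ∀ {W : List V}, IsWalk ω W → (∀ x y, [x, y] <:+: W → s(x, y) ∈ ω → s(x, y) ∈ ω') → IsWalk ω' W
  | [], _, _ => trivial
  | [_], _, _ => trivial
  | a :: b :: l, hW, h =>
    ⟨h a b (pair_infix_cons_cons a b l) hW.1,
      IsWalk.of_forall_mem hW.2 fun x y hxy => h x y (List.infix_cons hxy)⟩

/-- **Relabelling**: the image of an `ω`-walk under a map of the vertices is a walk of the image
configuration (`List.isChain_map`, `List.IsChain.imp`). [folklore] -/
theorem isWalk_map {V' : Type*} (σ : V → V') {ω : Set (Sym2 V)} {W : List V} (hW : IsWalk ω W) :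
    IsWalk ((Sym2.map σ) '' ω) (W.map σ) := by
  rw [isWalk_iff_isChain, List.isChain_map]
  exact ((isWalk_iff_isChain ω W).1 hW).imp fun a b h => ⟨s(a, b), h, by simp⟩

/-! ### The corners of a triangle -/

/-- The index of the third corner. [folklore] -/
def thirdIdx (i j : Fin 3) : Fin 3 := ⟨(3 - (i.1 + j.1)) % 3, Nat.mod_lt _ (by norm_num)⟩

/-- The third corner is not the first. [folklore] -/
theorem thirdIdx_ne_left {i j : Fin 3} (h : i ≠ j) : thirdIdx i j ≠ i := by
  revert h; fin_cases i <;> fin_cases j <;> decide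

/-- The third corner is not the second. [folklore] -/
theorem thirdIdx_ne_right {i j : Fin 3} (h : i ≠ j) : thirdIdx i j ≠ j := by
  revert h; fin_cases i <;> fin_cases j <;> decide

/-- A corner other than `i` and `j ≠ i` is the third one. [folklore] -/
theorem eq_thirdIdx_of_ne_of_ne {i j k : Fin 3} (h : i ≠ j) (hi : k ≠ i) (hj : k ≠ j) : k = thirdIdx i j := by
  revert h hi hj; fin_cases i <;> fin_cases j <;> fin_cases k <;> decide

/-- The triangle edge opposite the third corner joins the two given corners. [folklore] -/
theorem triEdge_thirdIdx (v : Fin 3 → V) {i j : Fin 3} (h : i ≠ j) : triEdge v (thirdIdx i j) = s(v i, v j) := by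
  revert h; fin_cases i <;> fin_cases j <;> intro h <;> first | exact absurd rfl h | (simp [triEdge, fst3, snd3, thirdIdx]; try exact Sym2.eq_swap)

/-- The triangle edge opposite `i` joins `j` to the third corner. [folklore] -/
theorem triEdge_left_eq (v : Fin 3 → V) {i j : Fin 3} (h : i ≠ j) : triEdge v i = s(v j, v (thirdIdx i j)) := by
  revert h; fin_cases i <;> fin_cases j <;> intro h <;> first | exact absurd rfl h | (simp [triEdge, fst3, snd3, thirdIdx]; try exact Sym2.eq_swap)

/-- The triangle edge opposite `j` joins `i` to the third corner. [folklore] -/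
theorem triEdge_right_eq (v : Fin 3 → V) {i j : Fin 3} (h : i ≠ j) : triEdge v j = s(v i, v (thirdIdx i j)) := by
  revert h; fin_cases i <;> fin_cases j <;> intro h <;> first | exact absurd rfl h | (simp [triEdge, fst3, snd3, thirdIdx]; try exact Sym2.eq_swap)

/-- Two vertices form a **corner pair** if they are distinct corners of the triangle, i.e. the
endpoints of a triangle edge. [folklore] -/
def IsCornerPair (v : Fin 3 → V) (a b : V) : Prop := a ≠ b ∧ (∃ i, v i = a) ∧ ∃ j, v j = b

/-- A triangle edge is spanned by a corner pair. [folklore] -/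
theorem isCornerPair_of_eq_triEdge {v : Fin 3 → V} (hv : Function.Injective v) {a b : V} {k : Fin 3}
    (h : s(a, b) = triEdge v k) : IsCornerPair v a b := by
  rw [triEdge, Sym2.eq_iff] at h
  have hne : fst3 k ≠ snd3 k := by fin_cases k <;> decide
  rcases h with ⟨rfl, rfl⟩ | ⟨rfl, rfl⟩
  · exact ⟨fun h => hne (hv h), ⟨_, rfl⟩, ⟨_, rfl⟩⟩
  · exact ⟨fun h => hne (hv h.symm), ⟨_, rfl⟩, ⟨_, rfl⟩⟩

/-- An edge at the centre that is a star edge: its other endpoint is a corner. [folklore] -/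
theorem eq_corner_of_mem {v : Fin 3 → V} {O : V} (hvO : ∀ k, v k ≠ O) {ω : Set (Sym2 V)}
    (hOst : ∀ e ∈ ω, O ∈ e → ∃ k, e = starEdge v O k) {a : V} (ha : s(a, O) ∈ ω) : ∃ i, a = v i := by
  obtain ⟨k, hk⟩ := hOst _ ha (Sym2.mem_mk_right _ _)
  rw [starEdge, Sym2.eq_iff] at hk
  rcases hk with ⟨rfl, h⟩ | ⟨h, -⟩
  · exact absurd h.symm (hvO k)
  · exact ⟨k, h⟩

/-- Off the hexagon the triangle → star move changes nothing: an old open edge avoiding the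
centre and not a triangle edge stays open. [folklore] -/
theorem mem_tMove_of_mem {p : Sym2 V → unitInterval} {v : Fin 3 → V} {O : V} {ω : Set (Sym2 V)}
    (hO : ∀ e ∈ ω, O ∉ e) {e : Sym2 V} (he : e ∈ ω) (hT : ∀ k, e ≠ triEdge v k) (u : unitInterval) :
    e ∈ tMove p (triEdge v) (starEdge v O) ω u := by
  refine (mem_tMove_iff hT (fun k hk => ?_)).2 he
  exact hO e he (hk ▸ Sym2.mem_mk_left O (v k))

/-- Off the hexagon the star → triangle move changes nothing: an old open edge avoiding the
centre stays open (there are no old triangle edges). [folklore] -/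
theorem mem_sMove_of_mem {p : Sym2 V → unitInterval} {v : Fin 3 → V} {O : V} {ω : Set (Sym2 V)}
    (hT : ∀ k, triEdge v k ∉ ω) {e : Sym2 V} (he : e ∈ ω) (hO : O ∉ e) (u : unitInterval) :
    e ∈ sMove p (triEdge v) (starEdge v O) ω u := by
  refine (mem_sMove_iff (fun k hk => ?_) (fun k hk => ?_)).2 he
  · exact hT k (hk ▸ he)
  · exact hO (hk ▸ Sym2.mem_mk_left O (v k))

section Dec

variable [DecidableEq V]

/-- Being a corner pair is decidable. [folklore] -/
instance (v : Fin 3 → V) (a b : V) : Decidable (IsCornerPair v a b) :=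
  inferInstanceAs (Decidable (a ≠ b ∧ (∃ i, v i = a) ∧ ∃ j, v j = b))

/-- The index of a corner (`2` if `a` is not a corner). [folklore] -/
def cornerIdx (v : Fin 3 → V) (a : V) : Fin 3 := if v 0 = a then 0 else if v 1 = a then 1 else 2

/-- `cornerIdx` inverts an injective labelling of the corners. [folklore] -/
theorem cornerIdx_apply {v : Fin 3 → V} (hv : Function.Injective v) (i : Fin 3) : cornerIdx v (v i) = i := by
  unfold cornerIdx
  fin_cases i <;> simp [hv.eq_iff]

/-- The third corner of the triangle, given two of its corners as vertices. [folklore] -/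
def third (v : Fin 3 → V) (a b : V) : V := v (thirdIdx (cornerIdx v a) (cornerIdx v b))

/-- A corner pair spans a triangle edge. [folklore] -/
theorem IsCornerPair.eq_triEdge {v : Fin 3 → V} (hv : Function.Injective v) {a b : V} (h : IsCornerPair v a b) :
    s(a, b) = triEdge v (thirdIdx (cornerIdx v a) (cornerIdx v b)) := by
  obtain ⟨hab, ⟨i, rfl⟩, ⟨j, rfl⟩⟩ := h
  have hij : i ≠ j := fun h => hab (congrArg v h)
  rw [cornerIdx_apply hv, cornerIdx_apply hv, triEdge_thirdIdx v hij]

/-! ### The triangle → star move on walks -/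

/-- **Transport of a walk by the triangle → star move**: every traversal of a triangle edge
`ab` is replaced by `a O b` (GM14 Fig. 5.4, left column). [cite: GrimmettManolescu2014Isoradial, §5.2] -/
def subdivide (v : Fin 3 → V) (O : V) : List V → List V
  | [] => []
  | [a] => [a]
  | a :: b :: l => if IsCornerPair v a b then a :: O :: subdivide v O (b :: l) else a :: subdivide v O (b :: l)

/-- `subdivide` of the empty walk. [folklore] -/
@[simp] theorem subdivide_nil (v : Fin 3 → V) (O : V) : subdivide v O [] = [] := rfl

/-- `subdivide` of a single vertex. [folklore] -/
@[simp] theorem subdivide_singleton (v : Fin 3 → V) (O a : V) : subdivide v O [a] = [a] := rfl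

/-- Unfolding `subdivide` at a cons-cons. [folklore] -/
theorem subdivide_cons_cons (v : Fin 3 → V) (O a b : V) (l : List V) :
    subdivide v O (a :: b :: l) =
      if IsCornerPair v a b then a :: O :: subdivide v O (b :: l) else a :: subdivide v O (b :: l) := rfl

/-- `subdivide` keeps the first vertex. [folklore] -/
theorem head?_subdivide (v : Fin 3 → V) (O : V) : ∀ W : List V, (subdivide v O W).head? = W.head?
  | [] => rfl
  | [_] => rfl
  | a :: b :: l => by rw [subdivide_cons_cons]; split_ifs <;> rfl

/-- `subdivide` of a nonempty list is nonempty. [folklore] -/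
theorem subdivide_ne_nil (v : Fin 3 → V) (O : V) : ∀ {W : List V}, W ≠ [] → subdivide v O W ≠ []
  | [], h => absurd rfl h
  | [_], _ => by simp
  | a :: b :: l, _ => by rw [subdivide_cons_cons]; split_ifs <;> simp

/-- `subdivide` keeps the last vertex. [folklore] -/
theorem getLast?_subdivide (v : Fin 3 → V) (O : V) : ∀ W : List V, (subdivide v O W).getLast? = W.getLast?
  | [] => rfl
  | [_] => rfl
  | a :: b :: l => by
    have ih := getLast?_subdivide v O (b :: l)
    have hne : subdivide v O (b :: l) ≠ [] := subdivide_ne_nil v O (by simp)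
    rw [subdivide_cons_cons, List.getLast?_cons_cons]
    split_ifs
    · rw [List.getLast?_cons_cons, getLast?_cons_of_ne_nil hne, ih]
    · rw [getLast?_cons_of_ne_nil hne, ih]

/-- **Provenance of the vertices**: a vertex of the transported walk is an old vertex or the
centre. [cite: GrimmettManolescu2014Isoradial, §5.2] -/
theorem mem_subdivide (v : Fin 3 → V) (O : V) {x : V} : ∀ {W : List V}, x ∈ subdivide v O W → x ∈ W ∨ x = O
  | [], h => by simp at h
  | [a], h => by rw [subdivide_singleton] at h; exact Or.inl h
  | a :: b :: l, h => by
    have lift : x ∈ subdivide v O (b :: l) → x ∈ a :: b :: l ∨ x = O := fun h' => by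
      rcases mem_subdivide v O (W := b :: l) h' with h' | h'
      · exact Or.inl (List.mem_cons_of_mem _ h')
      · exact Or.inr h'
    rw [subdivide_cons_cons] at h
    split_ifs at h
    · rcases List.mem_cons.1 h with rfl | h
      · exact Or.inl (by simp)
      rcases List.mem_cons.1 h with rfl | h
      · exact Or.inr rfl
      · exact lift h
    · rcases List.mem_cons.1 h with rfl | h
      · exact Or.inl (by simp)
      · exact lift h

/-- Old vertices stay. [folklore] -/
theorem mem_subdivide_of_mem (v : Fin 3 → V) (O : V) {x : V} : ∀ {W : List V}, x ∈ W → x ∈ subdivide v O W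
  | [], h => by simp at h
  | [a], h => by rw [subdivide_singleton]; exact h
  | a :: b :: l, h => by
    rw [subdivide_cons_cons]
    rcases List.mem_cons.1 h with rfl | h
    · split_ifs <;> simp
    · have ih := mem_subdivide_of_mem v O (W := b :: l) h
      split_ifs
      · exact List.mem_cons_of_mem _ (List.mem_cons_of_mem _ ih)
      · exact List.mem_cons_of_mem _ ih

/-- The centre enters the transported walk only through the traversal of a triangle edge.
[cite: GrimmettManolescu2014Isoradial, §5.2] -/
theorem exists_pair_of_mem_subdivide (v : Fin 3 → V) (O : V) :
    ∀ {W : List V}, O ∉ W → O ∈ subdivide v O W → ∃ a b, [a, b] <:+: W ∧ IsCornerPair v a b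
  | [], _, h => by simp at h
  | [a], hO, h => by rw [subdivide_singleton] at h; exact absurd h hO
  | a :: b :: l, hO, h => by
    rw [subdivide_cons_cons] at h
    split_ifs at h with hc
    · exact ⟨a, b, pair_infix_cons_cons a b l, hc⟩
    · rcases List.mem_cons.1 h with rfl | h
      · exact absurd (by simp) hO
      · obtain ⟨a', b', h1, h2⟩ := exists_pair_of_mem_subdivide v O (W := b :: l)
          (fun h' => hO (List.mem_cons_of_mem _ h')) h
        exact ⟨a', b', List.infix_cons h1, h2⟩

/-- **Provenance of the edges**: two consecutive vertices of the transported walk were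
consecutive before, or are a corner and the centre (in either order) coming from the traversal
of a triangle edge at that corner. [cite: GrimmettManolescu2014Isoradial, §5.2] -/
theorem infix_pair_subdivide (v : Fin 3 → V) (O : V) {x y : V} :
    ∀ {W : List V}, [x, y] <:+: subdivide v O W →
      [x, y] <:+: W ∨ ∃ a b, [a, b] <:+: W ∧ IsCornerPair v a b ∧ ((x = a ∧ y = O) ∨ (x = O ∧ y = b))
  | [], h => by simp at h
  | [a], h => by have := h.length_le; simp at this
  | a :: b :: l, h => by
    have hab : [a, b] <:+: a :: b :: l := pair_infix_cons_cons a b l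
    have lift : ([x, y] <:+: b :: l ∨ ∃ a' b', [a', b'] <:+: b :: l ∧ IsCornerPair v a' b' ∧
        ((x = a' ∧ y = O) ∨ (x = O ∧ y = b'))) →
        ([x, y] <:+: a :: b :: l ∨ ∃ a' b', [a', b'] <:+: a :: b :: l ∧ IsCornerPair v a' b' ∧
          ((x = a' ∧ y = O) ∨ (x = O ∧ y = b'))) := by
      rintro (h | ⟨a', b', h1, h2, h3⟩)
      · exact Or.inl (List.infix_cons h)
      · exact Or.inr ⟨a', b', List.infix_cons h1, h2, h3⟩
    have hhd : (subdivide v O (b :: l)).head? = some b := head?_subdivide v O (b :: l)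
    rw [subdivide_cons_cons] at h
    split_ifs at h with hc
    · rcases List.infix_cons_iff.1 h with h | h
      · obtain ⟨hxa, hy⟩ := pair_prefix_cons_iff.1 h
        have hyO : y = O := by simpa using (singleton_prefix_iff.1 hy).symm
        exact Or.inr ⟨a, b, hab, hc, Or.inl ⟨hxa, hyO⟩⟩
      rcases List.infix_cons_iff.1 h with h | h
      · obtain ⟨hxO, hy⟩ := pair_prefix_cons_iff.1 h
        have hyb : y = b := by
          have h1 := singleton_prefix_iff.1 hy
          rw [hhd] at h1
          simpa using h1.symm
        exact Or.inr ⟨a, b, hab, hc, Or.inr ⟨hxO, hyb⟩⟩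
      · exact lift (infix_pair_subdivide v O h)
    · rcases List.infix_cons_iff.1 h with h | h
      · obtain ⟨hxa, hy⟩ := pair_prefix_cons_iff.1 h
        have hyb : y = b := by
          have h1 := singleton_prefix_iff.1 hy
          rw [hhd] at h1
          simpa using h1.symm
        rw [hxa, hyb]
        exact Or.inl hab
      · exact lift (infix_pair_subdivide v O h)

/-- **The transported walk is open after the triangle → star move, for every value of the
uniform variable** (GM14 §5.2, last paragraph: "a star–triangle transformation maps an open
path of `G` to an open path of `G'`"; the star edges at the two ends of a traversed triangle edge
are open by `compatible_tMap`). Hypothesis: `ω` has no edge at the centre `O`. [cite: GrimmettManolescu2014Isoradial, §5.2] -/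
theorem isWalk_subdivide {p : Sym2 V → unitInterval} {v : Fin 3 → V} {O : V} (hv : Function.Injective v)
    (hvO : ∀ k, v k ≠ O) {ω : Set (Sym2 V)} (hO : ∀ e ∈ ω, O ∉ e) (u : unitInterval) :
    ∀ {W : List V}, IsWalk ω W → IsWalk (tMove p (triEdge v) (starEdge v O) ω u) (subdivide v O W)
  | [], _ => by simp
  | [_], _ => by simp
  | a :: b :: l, hW => by
    have ih := isWalk_subdivide (p := p) hv hvO hO u (W := b :: l) hW.2
    have hhead : (subdivide v O (b :: l)).head? = some b := head?_subdivide v O (b :: l)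
    rw [subdivide_cons_cons]
    split_ifs with hc
    · -- a triangle edge `ab` is traversed: both star edges at `a` and `b` are laid down
      obtain ⟨hab, ⟨i, rfl⟩, ⟨j, rfl⟩⟩ := hc
      have hij : i ≠ j := fun h => hab (congrArg v h)
      set t : Fin 3 → Bool := readLocal (triEdge v) ω with ht
      have htk : t (thirdIdx i j) = true := by
        simp only [ht, readLocal, triEdge_thirdIdx v hij, decide_eq_true_eq]; exact hW.1
      have hstar : ∀ k, starEdge v O k ∉ ω := fun k h => hO _ h (Sym2.mem_mk_left _ _)
      have hread := readLocal_tMove (p := p) (eT := triEdge v) (starEdge_injective hv hvO) hstar u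
      have hcompat := compatible_tMap (triParam p (triEdge v)) t u
      have htri : TriConn t i j := Or.inr (Or.inl fun k hki hkj => (eq_thirdIdx_of_ne_of_ne hij hki hkj) ▸ htk)
      have hsc : StarConn (tMap (triParam p (triEdge v)) t u) i j := (hcompat i j).1 htri
      have hmem : ∀ k, tMap (triParam p (triEdge v)) t u k = true →
          s(O, v k) ∈ tMove p (triEdge v) (starEdge v O) ω u := by
        intro k hk
        have h1 := congrFun hread k
        rw [← ht, hk] at h1
        simpa [readLocal, starEdge] using h1
      rcases hsc with h | ⟨hi, hj⟩
      · exact absurd h hij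
      · refine ⟨?_, ih.cons fun c hc' => ?_⟩
        · rw [Sym2.eq_swap]; exact hmem i hi
        · rw [hhead] at hc'; cases hc'; exact hmem j hj
    · refine ih.cons fun c hc' => ?_
      rw [hhead] at hc'; cases hc'
      exact mem_tMove_of_mem hO hW.1 (fun k hk => hc (isCornerPair_of_eq_triEdge hv hk)) u

/-! ### The star → triangle move on walks -/

/-- **Transport of a walk by the star → triangle move** with outcome `t` (the triangle
configuration laid down, `t k` = the edge opposite the corner `k`): a passage `a O b` through
the centre becomes the edge `a b` if it is laid down, the detour `a c b` through the third
corner `c` otherwise, and `a O a` becomes `a` (GM14 Fig. 5.4, right column; the "secondary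
outcome" of §6.2 is a detour). Conventions at the ends, where no passage is defined: a terminal
centre is dropped (`[a, O] ↦ [a]`: GM14 §5.2 "if `π` ends at the centre of this star […] the
endpoint of `σ(π)` is a vertex of the resulting triangle"), an initial centre is kept; the
lemmas below carry the side conditions (`head? ≠ O`, `getLast? ≠ O`) under which neither
matters. [cite: GrimmettManolescu2014Isoradial, §5.2] -/
def contract (v : Fin 3 → V) (O : V) (t : Fin 3 → Bool) : List V → List V
  | [] => []
  | [a] => [a]
  | [a, x] => if x = O then [a] else [a, x]
  | a :: x :: b :: l =>
    if x = O then
      (if a = b then contract v O t (b :: l)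
       else if t (thirdIdx (cornerIdx v a) (cornerIdx v b)) then a :: contract v O t (b :: l)
       else a :: third v a b :: contract v O t (b :: l))
    else a :: contract v O t (x :: b :: l)

/-- `contract` of the empty walk. [folklore] -/
@[simp] theorem contract_nil (v : Fin 3 → V) (O : V) (t : Fin 3 → Bool) : contract v O t [] = [] := rfl

/-- `contract` of a single vertex. [folklore] -/
@[simp] theorem contract_singleton (v : Fin 3 → V) (O : V) (t : Fin 3 → Bool) (a : V) : contract v O t [a] = [a] := rfl

/-- Unfolding `contract` on a pair. [folklore] -/
theorem contract_pair (v : Fin 3 → V) (O : V) (t : Fin 3 → Bool) (a x : V) :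
    contract v O t [a, x] = if x = O then [a] else [a, x] := rfl

/-- Unfolding `contract` on three or more vertices. [folklore] -/
theorem contract_cons_cons_cons (v : Fin 3 → V) (O : V) (t : Fin 3 → Bool) (a x b : V) (l : List V) :
    contract v O t (a :: x :: b :: l) =
      if x = O then
        (if a = b then contract v O t (b :: l)
         else if t (thirdIdx (cornerIdx v a) (cornerIdx v b)) then a :: contract v O t (b :: l)
         else a :: third v a b :: contract v O t (b :: l))
      else a :: contract v O t (x :: b :: l) := rfl

/-- `contract` keeps the first vertex if it is not the centre. [folklore] -/
theorem head?_contract (v : Fin 3 → V) (O : V) (t : Fin 3 → Bool) :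
    ∀ (W : List V), W.head? ≠ some O → (contract v O t W).head? = W.head? := by
  refine list_strong_induction fun W ih => ?_
  rcases W with _ | ⟨a, W⟩
  · intro; rfl
  rcases W with _ | ⟨x, W⟩
  · intro; rfl
  rcases W with _ | ⟨b, l⟩
  · intro; rw [contract_pair]; split_ifs <;> rfl
  · intro ha
    have ha' : a ≠ O := fun h => ha (by simp [h])
    rw [contract_cons_cons_cons]
    split_ifs with hx hab
    · subst hab
      rw [ih (a :: l) (by simp), List.head?_cons, List.head?_cons]
      simpa using ha'
    · rfl
    · rfl
    · rfl

/-- `contract` of a nonempty list is nonempty. [folklore] -/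
theorem contract_ne_nil (v : Fin 3 → V) (O : V) (t : Fin 3 → Bool) :
    ∀ {W : List V}, W ≠ [] → contract v O t W ≠ [] := by
  refine fun {W} => list_strong_induction (P := fun W => W ≠ [] → contract v O t W ≠ []) (fun W ih => ?_) W
  rcases W with _ | ⟨a, W⟩
  · intro h; exact absurd rfl h
  rcases W with _ | ⟨x, W⟩
  · intro; simp [contract]
  rcases W with _ | ⟨b, l⟩
  · intro; rw [contract_pair]; split_ifs <;> simp
  · intro
    rw [contract_cons_cons_cons]
    split_ifs
    · exact ih (b :: l) (by simp) (by simp)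
    all_goals simp

/-- `contract` keeps the last vertex if it is not the centre. [folklore] -/
theorem getLast?_contract (v : Fin 3 → V) (O : V) (t : Fin 3 → Bool) :
    ∀ (W : List V), W.getLast? ≠ some O → (contract v O t W).getLast? = W.getLast? := by
  refine list_strong_induction fun W ih => ?_
  rcases W with _ | ⟨a, W⟩
  · intro; rfl
  rcases W with _ | ⟨x, W⟩
  · intro; rfl
  rcases W with _ | ⟨b, l⟩
  · intro hl
    rw [contract_pair]
    split_ifs with hx
    · exact absurd (by simp [hx]) hl
    · rfl
  · intro hl
    have hl' : (b :: l).getLast? ≠ some O := by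
      rwa [List.getLast?_cons_cons, List.getLast?_cons_cons] at hl
    have hne : contract v O t (b :: l) ≠ [] := contract_ne_nil v O t (by simp)
    rw [contract_cons_cons_cons, List.getLast?_cons_cons, List.getLast?_cons_cons]
    split_ifs with hx hab ht
    · exact ih (b :: l) (by simp) hl'
    · rw [getLast?_cons_of_ne_nil hne, ih (b :: l) (by simp) hl']
    · rw [List.getLast?_cons_cons, getLast?_cons_of_ne_nil hne, ih (b :: l) (by simp) hl']
    · have hne' : contract v O t (x :: b :: l) ≠ [] := contract_ne_nil v O t (by simp)
      rw [getLast?_cons_of_ne_nil hne', ih (x :: b :: l) (by simp), List.getLast?_cons_cons]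
      rwa [List.getLast?_cons_cons]

/-- **Provenance of the vertices**: a vertex of the transported walk is an old vertex, or the
third corner `c` of a detour `a c b` replacing a passage `a O b` (`a ≠ b`) whose direct edge was
not laid down. [cite: GrimmettManolescu2014Isoradial, §5.2] -/
theorem mem_contract (v : Fin 3 → V) (O : V) (t : Fin 3 → Bool) {x : V} :
    ∀ (W : List V), x ∈ contract v O t W →
      x ∈ W ∨ ∃ a b, [a, O, b] <:+: W ∧ a ≠ b ∧ t (thirdIdx (cornerIdx v a) (cornerIdx v b)) = false ∧ x = third v a b := by
  refine list_strong_induction fun W ih => ?_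
  have lift : ∀ {y : V} {L : List V}, (x ∈ L ∨ ∃ a b, [a, O, b] <:+: L ∧ a ≠ b ∧
      t (thirdIdx (cornerIdx v a) (cornerIdx v b)) = false ∧ x = third v a b) →
      (x ∈ y :: L ∨ ∃ a b, [a, O, b] <:+: y :: L ∧ a ≠ b ∧
        t (thirdIdx (cornerIdx v a) (cornerIdx v b)) = false ∧ x = third v a b) := by
    rintro y L (h | ⟨a, b, h1, h2, h3, h4⟩)
    · exact Or.inl (List.mem_cons_of_mem _ h)
    · exact Or.inr ⟨a, b, List.infix_cons h1, h2, h3, h4⟩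
  rcases W with _ | ⟨a, W⟩
  · intro h; simp [contract] at h
  rcases W with _ | ⟨x', W⟩
  · intro h; simp [contract] at h; exact Or.inl (by simp [h])
  rcases W with _ | ⟨b, l⟩
  · intro h
    rw [contract_pair] at h
    split_ifs at h <;> simp only [List.mem_cons, List.not_mem_nil, or_false] at h
    · exact Or.inl (by simp [h])
    · rcases h with rfl | rfl <;> exact Or.inl (by simp)
  · intro h
    have habO : [a, O, b] <:+: a :: O :: b :: l :=
      triple_infix_cons_cons_cons a O b l
    rw [contract_cons_cons_cons] at h
    split_ifs at h with hx hab ht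
    · exact lift (lift (ih (b :: l) (by simp) h))
    · subst hx
      rcases List.mem_cons.1 h with rfl | h
      · exact Or.inl (by simp)
      · exact lift (lift (ih (b :: l) (by simp) h))
    · subst hx
      rcases List.mem_cons.1 h with rfl | h
      · exact Or.inl (by simp)
      rcases List.mem_cons.1 h with rfl | h
      · exact Or.inr ⟨a, b, habO, hab, Bool.eq_false_iff.2 ht, rfl⟩
      · exact lift (lift (ih (b :: l) (by simp) h))
    · rcases List.mem_cons.1 h with rfl | h
      · exact Or.inl (by simp)
      · exact lift (ih (x' :: b :: l) (by simp) h)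

/-- Old vertices other than the centre stay. [folklore] -/
theorem mem_contract_of_mem (v : Fin 3 → V) (O : V) (t : Fin 3 → Bool) {x : V} (hx : x ≠ O) :
    ∀ (W : List V), x ∈ W → x ∈ contract v O t W := by
  refine list_strong_induction fun W ih => ?_
  rcases W with _ | ⟨a, W⟩
  · intro h; simp at h
  rcases W with _ | ⟨x', W⟩
  · intro h; simpa [contract] using h
  rcases W with _ | ⟨b, l⟩
  · intro h
    rw [contract_pair]
    split_ifs with h1
    · subst h1
      rcases List.mem_cons.1 h with rfl | h
      · simp
      · simp at h; exact absurd h hx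
    · exact h
  · intro h
    rw [contract_cons_cons_cons]
    split_ifs with h1 hab ht
    · subst hab; subst h1
      rcases List.mem_cons.1 h with rfl | h
      · exact ih (x :: l) (by simp) (by simp)
      rcases List.mem_cons.1 h with rfl | h
      · exact absurd rfl hx
      · exact ih (a :: l) (by simp) h
    · subst h1
      rcases List.mem_cons.1 h with rfl | h
      · simp
      rcases List.mem_cons.1 h with rfl | h
      · exact absurd rfl hx
      · exact List.mem_cons_of_mem _ (ih (b :: l) (by simp) h)
    · subst h1
      rcases List.mem_cons.1 h with rfl | h
      · simp
      rcases List.mem_cons.1 h with rfl | h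
      · exact absurd rfl hx
      · exact List.mem_cons_of_mem _ (List.mem_cons_of_mem _ (ih (b :: l) (by simp) h))
    · rcases List.mem_cons.1 h with rfl | h
      · simp
      · exact List.mem_cons_of_mem _ (ih (x' :: b :: l) (by simp) h)

/-- **The centre disappears**: after the star → triangle move the transported walk avoids the
centre (the walk does not start or end at it and never stays at it; the corners are not the
centre). [cite: GrimmettManolescu2014Isoradial, §5.2] -/
theorem not_mem_contract {v : Fin 3 → V} {O : V} (hvO : ∀ k, v k ≠ O) (t : Fin 3 → Bool) :
    ∀ (W : List V), W.head? ≠ some O → W.getLast? ≠ some O → ¬ [O, O] <:+: W → O ∉ contract v O t W := by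
  refine list_strong_induction fun W ih => ?_
  rcases W with _ | ⟨a, W⟩
  · intro _ _ _; simp [contract]
  rcases W with _ | ⟨x, W⟩
  · intro h _ _; simp only [contract, List.mem_singleton]
    exact fun h' => h (by simp [h'])
  rcases W with _ | ⟨b, l⟩
  · intro hh hl _
    have ha : a ≠ O := fun h' => hh (by simp [h'])
    rw [contract_pair]
    split_ifs with hx
    · simpa using ha.symm
    · simp only [List.mem_cons, List.not_mem_nil, or_false, not_or]
      exact ⟨ha.symm, fun h => hx h.symm⟩
  · intro hh hl hOO
    have ha : a ≠ O := fun h' => hh (by simp [h'])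
    have hl' : (b :: l).getLast? ≠ some O := by
      rwa [List.getLast?_cons_cons, List.getLast?_cons_cons] at hl
    have hOO' : ¬ [O, O] <:+: b :: l := fun h' => hOO (List.infix_cons (List.infix_cons h'))
    rw [contract_cons_cons_cons]
    split_ifs with hx hab ht
    · subst hab; subst hx
      exact ih (a :: l) (by simp) (by simpa using ha) hl' hOO'
    · subst hx
      have hb : b ≠ x := by
        rintro rfl
        exact hOO (List.infix_cons (pair_infix_cons_cons b b l))
      simp only [List.mem_cons, not_or]
      exact ⟨ha.symm, ih (b :: l) (by simp) (by simpa using hb) hl' hOO'⟩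
    · subst hx
      have hb : b ≠ x := by
        rintro rfl
        exact hOO (List.infix_cons (pair_infix_cons_cons b b l))
      simp only [List.mem_cons, not_or]
      exact ⟨ha.symm, (hvO _).symm, ih (b :: l) (by simp) (by simpa using hb) hl' hOO'⟩
    · have hxh : (x :: b :: l).head? ≠ some O := by simpa using hx
      have hOO'' : ¬ [O, O] <:+: x :: b :: l := fun h' => hOO (List.infix_cons h')
      simp only [List.mem_cons, not_or]
      refine ⟨ha.symm, ih (x :: b :: l) (by simp) hxh ?_ hOO''⟩
      rw [List.getLast?_cons_cons] at hl; exact hl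

/-- **Provenance of the edges**: two consecutive vertices of the transported walk were
consecutive before, or come from a passage `a O b` (`a ≠ b`): the laid-down edge `a b`, or one
of the two edges `a c`, `c b` of the detour. Hypotheses: the walk does not start at the centre
and never stays at it. [cite: GrimmettManolescu2014Isoradial, §5.2] -/
theorem infix_pair_contract (v : Fin 3 → V) (O : V) (t : Fin 3 → Bool) {x y : V} :
    ∀ (W : List V), W.head? ≠ some O → ¬ [O, O] <:+: W → [x, y] <:+: contract v O t W →
      [x, y] <:+: W ∨ ∃ a b, [a, O, b] <:+: W ∧ a ≠ b ∧
        ((t (thirdIdx (cornerIdx v a) (cornerIdx v b)) = true ∧ x = a ∧ y = b) ∨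
         (t (thirdIdx (cornerIdx v a) (cornerIdx v b)) = false ∧
           ((x = a ∧ y = third v a b) ∨ (x = third v a b ∧ y = b)))) := by
  refine list_strong_induction fun W ih => ?_
  have lift : ∀ {z : V} {L : List V}, ([x, y] <:+: L ∨ ∃ a b, [a, O, b] <:+: L ∧ a ≠ b ∧
      ((t (thirdIdx (cornerIdx v a) (cornerIdx v b)) = true ∧ x = a ∧ y = b) ∨
       (t (thirdIdx (cornerIdx v a) (cornerIdx v b)) = false ∧
         ((x = a ∧ y = third v a b) ∨ (x = third v a b ∧ y = b))))) →
      ([x, y] <:+: z :: L ∨ ∃ a b, [a, O, b] <:+: z :: L ∧ a ≠ b ∧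
      ((t (thirdIdx (cornerIdx v a) (cornerIdx v b)) = true ∧ x = a ∧ y = b) ∨
       (t (thirdIdx (cornerIdx v a) (cornerIdx v b)) = false ∧
         ((x = a ∧ y = third v a b) ∨ (x = third v a b ∧ y = b))))) := by
    rintro z L (h | ⟨a, b, h1, h2⟩)
    · exact Or.inl (List.infix_cons h)
    · exact Or.inr ⟨a, b, List.infix_cons h1, h2⟩
  rcases W with _ | ⟨a, W⟩
  · intro _ _ h; simp [contract] at h
  rcases W with _ | ⟨x', W⟩
  · intro _ _ h; have := h.length_le; simp [contract] at this
  rcases W with _ | ⟨b, l⟩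
  · intro _ _ h
    rw [contract_pair] at h
    split_ifs at h with h1
    · have := h.length_le; simp at this
    · exact Or.inl h
  · intro hhead hOO h
    have ha : a ≠ O := fun h' => hhead (by simp [h'])
    have habO : [a, O, b] <:+: a :: O :: b :: l :=
      triple_infix_cons_cons_cons a O b l
    have hOO' : ¬ [O, O] <:+: b :: l := fun h' => hOO (List.infix_cons (List.infix_cons h'))
    have hOO'' : ¬ [O, O] <:+: x' :: b :: l := fun h' => hOO (List.infix_cons h')
    rw [contract_cons_cons_cons] at h
    split_ifs at h with h1 hab ht
    · subst hab; subst h1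
      exact lift (lift (ih (a :: l) (by simp) (by simpa using ha) hOO' h))
    · subst h1
      have hb : b ≠ x' := by
        rintro rfl
        exact hOO (List.infix_cons (pair_infix_cons_cons b b l))
      have hbh : (b :: l).head? ≠ some x' := by simpa using hb
      rcases List.infix_cons_iff.1 h with h | h
      · obtain ⟨hxa, hy⟩ := pair_prefix_cons_iff.1 h
        rw [singleton_prefix_iff, head?_contract v x' t (b :: l) hbh] at hy
        have hyb : y = b := by simpa using hy.symm
        exact Or.inr ⟨a, b, habO, hab, Or.inl ⟨ht, hxa, hyb⟩⟩
      · exact lift (lift (ih (b :: l) (by simp) hbh hOO' h))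
    · subst h1
      have hb : b ≠ x' := by
        rintro rfl
        exact hOO (List.infix_cons (pair_infix_cons_cons b b l))
      have hbh : (b :: l).head? ≠ some x' := by simpa using hb
      rcases List.infix_cons_iff.1 h with h | h
      · obtain ⟨hxa, hy⟩ := pair_prefix_cons_iff.1 h
        have hyc : y = third v a b := by simpa using (singleton_prefix_iff.1 hy).symm
        exact Or.inr ⟨a, b, habO, hab, Or.inr ⟨Bool.eq_false_iff.2 ht, Or.inl ⟨hxa, hyc⟩⟩⟩
      rcases List.infix_cons_iff.1 h with h | h
      · obtain ⟨hxc, hy⟩ := pair_prefix_cons_iff.1 h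
        rw [singleton_prefix_iff, head?_contract v x' t (b :: l) hbh] at hy
        have hyb : y = b := by simpa using hy.symm
        exact Or.inr ⟨a, b, habO, hab, Or.inr ⟨Bool.eq_false_iff.2 ht, Or.inr ⟨hxc, hyb⟩⟩⟩
      · exact lift (lift (ih (b :: l) (by simp) hbh hOO' h))
    · have hxh : (x' :: b :: l).head? ≠ some O := by simpa using h1
      rcases List.infix_cons_iff.1 h with h | h
      · obtain ⟨hxa, hy⟩ := pair_prefix_cons_iff.1 h
        rw [singleton_prefix_iff, head?_contract v O t (x' :: b :: l) hxh] at hy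
        have hyx : y = x' := by simpa using hy.symm
        rw [hxa, hyx]
        exact Or.inl (pair_infix_cons_cons a x' (b :: l))
      · exact lift (ih (x' :: b :: l) (by simp) hxh hOO'' h)

/-- **The transported walk is open after the star → triangle move, for every value of the
uniform variable**, when `t` is the triangle configuration actually laid down: a passage `a O b`
uses two open star edges, so `a`, `b` are connected through the star, hence through the laid-down
triangle (`compatible_sMap`) — directly or via the third corner. Hypotheses: `ω` has no triangle
edge, its edges at `O` are star edges, and the walk does not start at `O`. [cite: GrimmettManolescu2014Isoradial, §5.2] -/
theorem isWalk_contract {p : Sym2 V → unitInterval} {v : Fin 3 → V} {O : V} (hv : Function.Injective v)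
    (hvO : ∀ k, v k ≠ O) {ω : Set (Sym2 V)} (hT : ∀ k, triEdge v k ∉ ω)
    (hOst : ∀ e ∈ ω, O ∈ e → ∃ k, e = starEdge v O k) (u : unitInterval) :
    ∀ (W : List V), IsWalk ω W → W.head? ≠ some O →
      IsWalk (sMove p (triEdge v) (starEdge v O) ω u)
        (contract v O (readLocal (triEdge v) (sMove p (triEdge v) (starEdge v O) ω u)) W) := by
  set ω' := sMove p (triEdge v) (starEdge v O) ω u with hω'
  set t : Fin 3 → Bool := readLocal (triEdge v) ω' with ht
  have hread : t = sMap (triParam p (triEdge v)) (readLocal (starEdge v O) ω) u :=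
    readLocal_sMove (triEdge_injective hv) hT u
  have hcompat : Compatible t (readLocal (starEdge v O) ω) := hread ▸ compatible_sMap _ _ _
  have htmem : ∀ k, t k = true ↔ triEdge v k ∈ ω' := fun k => by simp [ht, readLocal]
  refine list_strong_induction fun W ih => ?_
  rcases W with _ | ⟨a, W⟩
  · intro _ _; simp [contract]
  rcases W with _ | ⟨x, W⟩
  · intro _ _; simp [contract]
  have keep : ∀ {a x : V} {L : List V}, s(a, x) ∈ ω → a ≠ O → x ≠ O → s(a, x) ∈ ω' :=
    fun h ha hx => mem_sMove_of_mem hT h (by simp [ha.symm, hx.symm]) u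
  rcases W with _ | ⟨b, l⟩
  · intro hW hhead
    have ha : a ≠ O := fun h => hhead (by simp [h])
    rw [contract_pair]
    split_ifs with hx
    · simp
    · exact ⟨keep (L := []) hW.1 ha hx, trivial⟩
  · intro hW hhead
    have ha : a ≠ O := fun h => hhead (by simp [h])
    obtain ⟨h1, h2, h3⟩ : s(a, x) ∈ ω ∧ s(x, b) ∈ ω ∧ IsWalk ω (b :: l) := ⟨hW.1, hW.2.1, hW.2.2⟩
    rw [contract_cons_cons_cons]
    by_cases hx : x = O
    · subst hx
      obtain ⟨i, rfl⟩ := eq_corner_of_mem hvO hOst h1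
      obtain ⟨j, rfl⟩ := eq_corner_of_mem hvO hOst (by rw [Sym2.eq_swap]; exact h2)
      have hbh : (v j :: l).head? ≠ some x := by simpa using hvO j
      rw [if_pos rfl]
      by_cases hab : v i = v j
      · rw [if_pos hab]; exact ih (v j :: l) (by simp) h3 hbh
      rw [if_neg hab, cornerIdx_apply hv, cornerIdx_apply hv]
      have hij : i ≠ j := fun h => hab (congrArg v h)
      have hsi : readLocal (starEdge v x) ω i = true := by simpa [readLocal, starEdge, Sym2.eq_swap] using h1
      have hsj : readLocal (starEdge v x) ω j = true := by simpa [readLocal, starEdge] using h2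
      have htri : TriConn t i j := (hcompat i j).2 (Or.inr ⟨hsi, hsj⟩)
      have hih := ih (v j :: l) (by simp) h3 hbh
      have hhd : (contract v x t (v j :: l)).head? = some (v j) := head?_contract v x t _ hbh
      by_cases htk : t (thirdIdx i j) = true
      · rw [if_pos htk]
        refine hih.cons fun c hc => ?_
        rw [hhd] at hc; cases hc
        rw [← triEdge_thirdIdx v hij]; exact (htmem _).1 htk
      · rw [if_neg htk]
        have hdet : t i = true ∧ t j = true := by
          rcases htri with h | h | h
          · exact absurd h hij
          · exact absurd (h _ (thirdIdx_ne_left hij) (thirdIdx_ne_right hij)) htk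
          · exact h
        refine ⟨?_, hih.cons fun c hc => ?_⟩
        · show s(v i, third v (v i) (v j)) ∈ ω'
          rw [third, cornerIdx_apply hv, cornerIdx_apply hv, ← triEdge_right_eq v hij]
          exact (htmem _).1 hdet.2
        · rw [hhd] at hc; cases hc
          show s(third v (v i) (v j), v j) ∈ ω'
          rw [third, cornerIdx_apply hv, cornerIdx_apply hv, Sym2.eq_swap, ← triEdge_left_eq v hij]
          exact (htmem _).1 hdet.1
    · rw [if_neg hx]
      have hxh : (x :: b :: l).head? ≠ some O := by simpa using hx
      refine (ih (x :: b :: l) (by simp) hW.2 hxh).cons fun c hc => ?_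
      rw [head?_contract v O t _ hxh] at hc; cases hc
      exact keep (L := []) h1 ha hx

end Dec

end StarTriangle

end Literature.Probability.Percolation
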